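import Mathlib

/-!
# Shrunk subspaces, the Wong certificate and the Koszul rank drop — kernel plate for
`Cruxes/BlochSeedDiscOne/B1-EXACT-HANDLES-monad1-g5.md` §2 (L1), §4b (hsemireg-monad-1 g5, 2026-08-30)

Token: line stmt-HodgeConjecture-18881 Cruxes/BlochSeedDiscOne/Lines/birth.lean 814a6a70c14e831a
stub_rung_pad4_seedAt.  Plain finite-dimensional linear algebra over a field (Mathlib only, no sorry);
matrix spaces ≠ letter designs ≠ sheaves ≠ a SEED; nothing here is a statement toward HC / HC_CM /
HC_AV / 18881.  Three facts the memo's certificates rest on: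

* `finrank_range_add_le_of_isShrunk` — an `s`-shrunk subspace bounds the rank of EVERY element of the
  family by `finrank V - s` (the easy half of Fortin–Reutenauer; what a printed COMPRESSION line uses);
* `isShrunk_comap_of_wong` — the second-Wong-sequence certificate: if `W⋆ ≤ range A` and every member
  maps `A⁻¹ W⋆` into `W⋆`, then `A⁻¹ W⋆` is `(finrank V - rank A)`-shrunk, so `rank A` is the maximal
  (and the non-commutative) rank;
* `finrank_range_koszul_lt` — the Koszul vector `(s₂, -s₁)` forces `rank Φ < dim domain` for the
  two-block multiplication map `Φ(t₁,t₂) = s₁ t₁ + s₂ t₂` in a commutative algebra whenever it lies in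
  the domain (the mechanism of the six certified gaps `rk = ncrk - 1`).
-/

namespace Summit.HodgeConjecture.HodgeConjecture.Cruxes.BlochSeedDiscOne.ShrunkSubspace

open Module

section Shrunk

variable {K V W : Type*} [Field K] [AddCommGroup V] [Module K V] [AddCommGroup W] [Module K W]
  [FiniteDimensional K V] [FiniteDimensional K W]

/-- `U` is `s`-shrunk for the family `𝓑`: all images `B(U)`, `B ∈ 𝓑`, lie in one subspace `W'`
with `finrank W' + s ≤ finrank U`. -/
def IsShrunk (𝓑 : Set (V →ₗ[K] W)) (s : ℕ) (U : Submodule K V) : Prop :=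
  ∃ W' : Submodule K W, (∀ B ∈ 𝓑, U.map B ≤ W') ∧ finrank K W' + s ≤ finrank K U

/-- Shrunk-subspace bound: every member of a family with an `s`-shrunk subspace has
`rank + s ≤ finrank V`. -/
theorem finrank_range_add_le_of_isShrunk (𝓑 : Set (V →ₗ[K] W)) (s : ℕ) (U : Submodule K V)
    (h : IsShrunk 𝓑 s U) (B : V →ₗ[K] W) (hB : B ∈ 𝓑) :
    finrank K (LinearMap.range B) + s ≤ finrank K V := by
  obtain ⟨W', hmap, hdim⟩ := h
  obtain ⟨U', hU'⟩ := U.exists_isCompl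
  have htop : LinearMap.range B = U.map B ⊔ U'.map B := by
    rw [LinearMap.range_eq_map, ← Submodule.map_sup, hU'.sup_eq_top]
  have h1 : finrank K ↥(LinearMap.range B) ≤ finrank K ↥(U.map B) + finrank K ↥(U'.map B) := by
    rw [htop]
    have := Submodule.finrank_sup_add_finrank_inf_eq (U.map B) (U'.map B)
    omega
  have h2 : finrank K ↥(U.map B) ≤ finrank K ↥W' := Submodule.finrank_mono (hmap B hB)
  have h3 : finrank K ↥(U'.map B) ≤ finrank K ↥U' := Submodule.finrank_map_le B U'
  have h4 : finrank K ↥U + finrank K ↥U' = finrank K V := Submodule.finrank_add_eq_of_isCompl hU'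
  omega

/-- The Wong certificate.  If `W⋆ ≤ range A` and every member of the family maps `A⁻¹(W⋆)` into
`W⋆` (stability of the second Wong sequence inside `Im A`), then `A⁻¹(W⋆)` is
`(finrank V - rank A)`-shrunk. -/
theorem isShrunk_comap_of_wong (𝓑 : Set (V →ₗ[K] W)) (A : V →ₗ[K] W) (Wst : Submodule K W)
    (hle : Wst ≤ LinearMap.range A) (hstab : ∀ B ∈ 𝓑, (Wst.comap A).map B ≤ Wst) :
    IsShrunk 𝓑 (finrank K V - finrank K (LinearMap.range A)) (Wst.comap A) := by
  refine ⟨Wst, hstab, ?_⟩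
  -- rank–nullity for `A` restricted to `U := A⁻¹ W⋆`
  set U : Submodule K V := Wst.comap A with hU
  have hmapU : U.map A = Wst := by
    rw [hU, Submodule.map_comap_eq, inf_eq_right.mpr hle]
  have hrn := LinearMap.finrank_range_add_finrank_ker (A.domRestrict U)
  rw [LinearMap.range_domRestrict, hmapU, LinearMap.ker_domRestrict] at hrn
  -- `ker A ≤ U`, so `comap U.subtype (ker A) ≃ ker A`
  have hkerle : LinearMap.ker A ≤ U := by
    intro v hv
    rw [hU, Submodule.mem_comap, LinearMap.mem_ker.mp hv]
    exact Wst.zero_mem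
  have hker : finrank K ↥(Submodule.comap U.subtype (LinearMap.ker A)) = finrank K ↥(LinearMap.ker A) :=
    LinearEquiv.finrank_eq (Submodule.comapSubtypeEquivOfLe hkerle)
  have hrnA := LinearMap.finrank_range_add_finrank_ker A
  omega

/-- Consequence: under the Wong certificate every member has rank ≤ rank A (so `rank A` is the
commutative rank of the family and, by Fortin–Reutenauer, its non-commutative rank). -/
theorem finrank_range_le_of_wong (𝓑 : Set (V →ₗ[K] W)) (A : V →ₗ[K] W) (Wst : Submodule K W)
    (hle : Wst ≤ LinearMap.range A) (hstab : ∀ B ∈ 𝓑, (Wst.comap A).map B ≤ Wst)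
    (B : V →ₗ[K] W) (hB : B ∈ 𝓑) :
    finrank K (LinearMap.range B) ≤ finrank K (LinearMap.range A) := by
  have h := finrank_range_add_le_of_isShrunk 𝓑 _ _ (isShrunk_comap_of_wong 𝓑 A Wst hle hstab) B hB
  have hA : finrank K ↥(LinearMap.range A) ≤ finrank K V := by
    have := LinearMap.finrank_range_add_finrank_ker A
    omega
  omega

end Shrunk

section Koszul

variable {K R : Type*} [Field K] [CommRing R] [Algebra K R]

/-- The two-block multiplication map `Φ_{s₁,s₂}(t₁, t₂) = s₁ t₁ + s₂ t₂` on a pair of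
`K`-subspaces `V₁, V₂` of a commutative `K`-algebra. -/
def mulMap (s₁ s₂ : R) (V₁ V₂ : Submodule K R) : (↥V₁ × ↥V₂) →ₗ[K] R :=
  (LinearMap.mulLeft K s₁).comp (V₁.subtype.comp (LinearMap.fst K ↥V₁ ↥V₂)) +
  (LinearMap.mulLeft K s₂).comp (V₂.subtype.comp (LinearMap.snd K ↥V₁ ↥V₂))

@[simp] theorem mulMap_apply (s₁ s₂ : R) (V₁ V₂ : Submodule K R) (t : ↥V₁ × ↥V₂) :
    mulMap s₁ s₂ V₁ V₂ t = s₁ * (t.1 : R) + s₂ * (t.2 : R) := by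
  simp [mulMap]

/-- The Koszul vector `(s₂, -s₁)` lies in the kernel. -/
theorem koszul_mem_ker (s₁ s₂ : R) (V₁ V₂ : Submodule K R) (h₂ : s₂ ∈ V₁) (h₁ : s₁ ∈ V₂) :
    ((⟨s₂, h₂⟩, -⟨s₁, h₁⟩) : ↥V₁ × ↥V₂) ∈ LinearMap.ker (mulMap s₁ s₂ V₁ V₂) := by
  rw [LinearMap.mem_ker, mulMap_apply]
  simp only [Submodule.coe_neg]
  ring

/-- Koszul rank drop: if `(s₁, s₂) ≠ 0` and the Koszul vector lies in the domain
(`s₂ ∈ V₁`, `s₁ ∈ V₂`: the class identity `c - n₂ = n₁ - a` of the memo), then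
`rank Φ_{s₁,s₂} < finrank V₁ + finrank V₂` — for EVERY such `(s₁, s₂)`, while no fixed subspace is
responsible. -/
theorem finrank_range_koszul_lt (s₁ s₂ : R) (V₁ V₂ : Submodule K R)
    [FiniteDimensional K ↥V₁] [FiniteDimensional K ↥V₂]
    (h₂ : s₂ ∈ V₁) (h₁ : s₁ ∈ V₂) (hne : s₁ ≠ 0 ∨ s₂ ≠ 0) :
    finrank K (LinearMap.range (mulMap s₁ s₂ V₁ V₂)) < finrank K ↥V₁ + finrank K ↥V₂ := by
  have hrn := LinearMap.finrank_range_add_finrank_ker (mulMap s₁ s₂ V₁ V₂)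
  have hdom : finrank K (↥V₁ × ↥V₂) = finrank K ↥V₁ + finrank K ↥V₂ := Module.finrank_prod
  have hbot : LinearMap.ker (mulMap s₁ s₂ V₁ V₂) ≠ ⊥ := by
    intro hbot
    have hmem := koszul_mem_ker s₁ s₂ V₁ V₂ h₂ h₁
    rw [hbot, Submodule.mem_bot] at hmem
    have h0' := congrArg Subtype.val (congrArg Prod.fst hmem)
    have h0'' := congrArg Subtype.val (congrArg Prod.snd hmem)
    simp only [Prod.fst_zero, Prod.snd_zero, Submodule.coe_neg, ZeroMemClass.coe_zero,
      neg_eq_zero] at h0' h0''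
    rcases hne with h | h
    · exact h h0''
    · exact h h0'
  have hk : finrank K ↥(LinearMap.ker (mulMap s₁ s₂ V₁ V₂)) ≠ 0 :=
    fun h => hbot (Submodule.finrank_eq_zero.mp h)
  omega

end Koszul

end Summit.HodgeConjecture.HodgeConjecture.Cruxes.BlochSeedDiscOne.ShrunkSubspace
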